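import Mathlib.NumberTheory.ArithmeticFunction.Zeta
import Mathlib.NumberTheory.ArithmeticFunction.Defs
import Mathlib.NumberTheory.Padics.PadicNumbers
import Literature.NumberTheory.ModularForms.DedekindSumRademacherPhi
import Summits.BirchSwinnertonDyer.BirchSwinnertonDyer.Theorems.EisensteinDepletionAtTwoStarDefs
import HarnessLib

/-!
# Route `EisensteinDepletionAtTwo`, crux E1M `DepletedLambdaLawAtTwoMod` (item stmt-BirchSwinnertonDyer-20341),
# line `star`, Eisenstein half (★-EisNorm) — §A–§B: the stabilisation coefficients `c_t = stabCoeff N β t`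
# (Euler products of their divisor sums, `∑ c_t = 0`, `∑ c_t·t = 0`, `c_t ∈ ℤ₂`)

Cell `bsd-rank2` (HOME run/shared/lean/pub/bsd-rank2/), seat `bsd-rank2-eng-2` GEN 8. THEOREMS ONLY — no definition, no named
fact, no `sorry`. HONEST FRAMING: elementary bookkeeping about the coefficients `c_t` (`t ∣ N`) of the stabilised / depleted
weight-2 Eisenstein series of line `star` (definitions `localStabCoeff`, `stabCoeff`, `IsAdmissibleStabData` of
`Theorems/EisensteinDepletionAtTwoStarDefs.lean`, p554176); it is the input of the finite-level form (★-EisFin) of the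
Eisenstein half of (★) (evidence #39 on the item: after Stevens smoothing the boundary term `c_β·(Bézout junk)` is `≡ 0 mod 16`
because `‖c_β‖₂ ≤ 2⁻⁴`). Nothing here reads an analytic rank; (★)/E1M are NOT proved by this file; BSD is not proved by any of
this (PARTITION D-0054: none — r_an ≥ 2 axis S0, door T-r3₂). The lead's skeleton `Cruxes/…/Lines/star.lean` v2.4 proves the
two vanishing sums in-file over its local copies of the same definitions (N2); this file is the importable Theorems-side version.

* §A `sum_divisors_eq_prod_primeFactors` — for `F` multiplicative on coprime nonzero arguments with `F 1 = 1`: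
  `∑_{t ∣ N} F t = ∏_{ℓ ∣ N} ∑_{j ≤ v_ℓ(N)} F(ℓ^j)` (`(F ⋆ ζ)` is multiplicative: Mathlib `IsMultiplicative.mul`,
  `coe_mul_zeta_apply`, `multiplicative_factorization`, `sum_divisors_prime_pow`).
* §B `stabCoeff_mul` (multiplicativity), `stabCoeff_prime_pow`, the local factors `1 − (β_ℓ/ℓ)x` / `1 − ((1+ℓ)/ℓ)x + (1/ℓ)x²`,
  **`sum_divisors_stabCoeff_eq_zero`** (`∑ c_t = 0`: modularity) and **`sum_divisors_stabCoeff_mul_self_eq_zero`**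
  (`∑ c_t·t = 0`: cuspidality at `∞`) under `IsAdmissibleStabData`; for odd `N`: `norm_stabCoeff_le_one` (`c_t ∈ ℤ₂`).
  (The bound `‖∑_{t ∣ N} c_t/t‖₂ ≤ 2⁻⁴` is the sequel file `…StarStabCoeffBoundary.lean`.)

References: G. Stevens, *Arithmetic on Modular Curves*, Progress in Math. 20 (1982), §2.4–2.5, §5.4 [Stevens1982];
H. Rademacher, E. Grosswald, *Dedekind Sums*, Carus 16 (1972) [RademacherGrosswald1972].
-/

set_option linter.dupNamespace false
set_option autoImplicit false

noncomputable section

open scoped Classical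

namespace Summit.BirchSwinnertonDyer.BirchSwinnertonDyer.Theorems.DepletionAtTwo

/-! ## §A. Divisor sums of multiplicative functions -/

section DivisorSum

open ArithmeticFunction
open scoped ArithmeticFunction.zeta

/-- **Divisor sums of a multiplicative function are Euler products over the prime powers**: for `F : ℕ → R`
with `F 1 = 1` and `F (m n) = F m · F n` for coprime nonzero `m, n`, and `N ≠ 0`,
`∑_{t ∣ N} F t = ∏_{ℓ ∣ N prime} ∑_{j ≤ v_ℓ(N)} F(ℓ^j)` (`(F ⋆ ζ)` is multiplicative). [folklore] -/
theorem sum_divisors_eq_prod_primeFactors {R : Type*} [CommSemiring R] (F : ℕ → R) (hF1 : F 1 = 1)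
    (hF : ∀ m n : ℕ, m ≠ 0 → n ≠ 0 → Nat.Coprime m n → F (m * n) = F m * F n) {N : ℕ} (hN : N ≠ 0) :
    ∑ t ∈ N.divisors, F t = ∏ ℓ ∈ N.primeFactors, ∑ j ∈ Finset.range (N.factorization ℓ + 1), F (ℓ ^ j) := by
  -- package `F` as an arithmetic function (value `0` at `0`)
  set f : ArithmeticFunction R := ⟨fun n ↦ if n = 0 then 0 else F n, if_pos rfl⟩ with hf_def
  have hf_apply : ∀ n : ℕ, n ≠ 0 → f n = F n := fun n hn ↦ by
    show (if n = 0 then 0 else F n) = F n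
    rw [if_neg hn]
  have hf_mult : f.IsMultiplicative := by
    refine ⟨by rw [hf_apply 1 one_ne_zero, hF1], fun {m n} hmn ↦ ?_⟩
    rcases eq_or_ne m 0 with rfl | hm
    · have : n = 1 := by simpa using hmn
      subst this
      simp [hf_apply 1 one_ne_zero, hF1]
    rcases eq_or_ne n 0 with rfl | hn
    · have : m = 1 := by simpa using hmn
      subst this
      simp [hf_apply 1 one_ne_zero, hF1]
    rw [hf_apply _ (mul_ne_zero hm hn), hf_apply _ hm, hf_apply _ hn, hF m n hm hn hmn]
  have hfz : (f * ζ).IsMultiplicative := hf_mult.mul isMultiplicative_zeta.natCast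
  -- `(f ⋆ ζ)(N) = ∑_{t ∣ N} F t`
  have hsum : ∀ M : ℕ, M ≠ 0 → (f * ζ) M = ∑ t ∈ M.divisors, F t := fun M hM ↦ by
    rw [coe_mul_zeta_apply]
    exact Finset.sum_congr rfl fun t ht ↦ hf_apply t (Nat.ne_of_gt (Nat.pos_of_mem_divisors ht))
  rw [← hsum N hN, hfz.multiplicative_factorization _ hN, Finsupp.prod, Nat.support_factorization]
  refine Finset.prod_congr rfl fun ℓ hℓ ↦ ?_
  have hℓp : ℓ.Prime := Nat.prime_of_mem_primeFactors hℓ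
  rw [hsum _ (pow_ne_zero _ hℓp.ne_zero), Nat.sum_divisors_prime_pow hℓp]

end DivisorSum

/-! ## §B. The stabilisation coefficients `c_t = stabCoeff N β t` -/

section StabCoeff

variable (N : ℕ) (β : ℕ → ℕ)

/-- `c_ℓ(0) = 1` in every branch. [cite: Stevens1982, §2.4 (PDF pp. 35–37)] -/
theorem localStabCoeff_zero (ℓ : ℕ) : localStabCoeff N β ℓ 0 = 1 := by
  simp only [localStabCoeff, if_true]
  split_ifs <;> rfl

/-- `c_1 = 1`. [cite: Stevens1982, §2.4 (PDF pp. 35–37)] -/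
theorem stabCoeff_one : stabCoeff N β 1 = 1 := by
  unfold stabCoeff
  exact Finset.prod_eq_one fun ℓ _ ↦ by rw [Nat.factorization_one, Finsupp.zero_apply, localStabCoeff_zero]

/-- **`t ↦ c_t · w(t)` is multiplicative** for any `w` multiplicative on coprime nonzero arguments
(`c_{mn} = c_m c_n` for coprime `m, n`: at each prime at most one of `v_ℓ(m), v_ℓ(n)` is nonzero, and `c_ℓ(0) = 1`).
[cite: Stevens1982, §2.4 (PDF pp. 35–37)] -/
theorem stabCoeff_mul {m n : ℕ} (hm : m ≠ 0) (hn : n ≠ 0) (hmn : Nat.Coprime m n) :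
    stabCoeff N β (m * n) = stabCoeff N β m * stabCoeff N β n := by
  unfold stabCoeff
  rw [← Finset.prod_mul_distrib]
  refine Finset.prod_congr rfl fun ℓ _ ↦ ?_
  rw [Nat.factorization_mul hm hn, Finsupp.add_apply]
  -- at most one of the two exponents is nonzero
  by_cases hℓm : m.factorization ℓ = 0
  · rw [hℓm, zero_add, localStabCoeff_zero, one_mul]
  · have hℓn : n.factorization ℓ = 0 := by
      by_contra h
      have hpm : ℓ ∣ m := Nat.dvd_of_factorization_pos hℓm
      have hpn : ℓ ∣ n := Nat.dvd_of_factorization_pos h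
      have hℓ1 : ℓ = 1 := Nat.eq_one_of_dvd_coprimes hmn hpm hpn
      subst hℓ1
      exact hℓm (by simp)
    rw [hℓn, add_zero, localStabCoeff_zero, mul_one]

/-- The divisor sum `∑_{t ∣ N} c_t·w(t)` of the weighted coefficients, for a multiplicative weight `w` with `w 1 = 1`,
is the Euler product `∏_ℓ ∑_{j ≤ v_ℓ(N)} c_ℓ-terms`. [cite: Stevens1982, §2.4 (PDF pp. 35–37)] -/
theorem sum_divisors_stabCoeff_mul {R : Type*} [CommRing R] [Algebra ℚ R] (w : ℕ → R) (hw1 : w 1 = 1)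
    (hw : ∀ m n : ℕ, m ≠ 0 → n ≠ 0 → Nat.Coprime m n → w (m * n) = w m * w n) (hN : N ≠ 0) :
    ∑ t ∈ N.divisors, algebraMap ℚ R (stabCoeff N β t) * w t =
      ∏ ℓ ∈ N.primeFactors, ∑ j ∈ Finset.range (N.factorization ℓ + 1),
        algebraMap ℚ R (stabCoeff N β (ℓ ^ j)) * w (ℓ ^ j) := by
  refine sum_divisors_eq_prod_primeFactors (fun t ↦ algebraMap ℚ R (stabCoeff N β t) * w t) ?_ ?_ hN
  · rw [stabCoeff_one, map_one, hw1, one_mul]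
  · intro m n hm hn hmn
    rw [stabCoeff_mul N β hm hn hmn, map_mul, hw m n hm hn hmn]
    ring

/-- `c_{ℓ^j} = c_ℓ(j)` for a prime `ℓ ∣ N`: the other primes of `N` contribute `c_{ℓ'}(0) = 1`.
[cite: Stevens1982, §2.4 (PDF pp. 35–37)] -/
theorem stabCoeff_prime_pow {ℓ : ℕ} (hℓ : ℓ ∈ N.primeFactors) (j : ℕ) :
    stabCoeff N β (ℓ ^ j) = localStabCoeff N β ℓ j := by
  have hℓp : ℓ.Prime := Nat.prime_of_mem_primeFactors hℓ
  unfold stabCoeff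
  rw [← Finset.mul_prod_erase _ _ hℓ, hℓp.factorization_pow, Finsupp.single_eq_same]
  conv_rhs => rw [← mul_one (localStabCoeff N β ℓ j)]
  congr 1
  refine Finset.prod_eq_one fun ℓ' hℓ' ↦ ?_
  rw [Finsupp.single_eq_of_ne (Finset.ne_of_mem_erase hℓ'), localStabCoeff_zero]

/-- The local factor `∑_{j ≤ v_ℓ(N)} c_ℓ(j)·x^j` at a prime `ℓ ∥ N`: `1 − (β_ℓ/ℓ)·x`. [cite: Stevens1982, §2.4 (PDF pp. 35–37)] -/
theorem sum_range_localStabCoeff_of_eq_one {R : Type*} [CommRing R] [Algebra ℚ R] {ℓ : ℕ}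
    (h1 : N.factorization ℓ = 1) (x : R) :
    ∑ j ∈ Finset.range (N.factorization ℓ + 1), algebraMap ℚ R (localStabCoeff N β ℓ j) * x ^ j =
      1 - algebraMap ℚ R ((β ℓ : ℚ) / ℓ) * x := by
  rw [h1]
  simp only [Finset.sum_range_succ, Finset.sum_range_zero, localStabCoeff, h1, if_true]
  simp only [show (1 : ℕ) ≠ 0 from one_ne_zero, if_false, pow_zero, pow_one, map_one, neg_div, map_neg]
  ring

/-- The local factor at a prime `ℓ² ∥ N` (full depletion): `1 − ((1+ℓ)/ℓ)·x + (1/ℓ)·x²`. [cite: Stevens1982, §2.4 (PDF pp. 35–37)] -/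
theorem sum_range_localStabCoeff_of_eq_two {R : Type*} [CommRing R] [Algebra ℚ R] {ℓ : ℕ}
    (h2 : N.factorization ℓ = 2) (x : R) :
    ∑ j ∈ Finset.range (N.factorization ℓ + 1), algebraMap ℚ R (localStabCoeff N β ℓ j) * x ^ j =
      1 - algebraMap ℚ R (((1 : ℚ) + ℓ) / ℓ) * x + algebraMap ℚ R ((1 : ℚ) / ℓ) * x ^ 2 := by
  rw [h2]
  simp only [Finset.sum_range_succ, Finset.sum_range_zero, localStabCoeff, h2, if_true,
    show (2 : ℕ) ≠ 1 from by decide, if_false]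
  simp only [show (1 : ℕ) ≠ 0 from one_ne_zero, show (2 : ℕ) ≠ 0 from two_ne_zero,
    if_false, pow_zero, pow_one, map_one, neg_div, map_neg]
  ring


/-! ### Consequences of admissibility: `∑ c_t = 0`, `∑ c_t t = 0` -/

variable {N β}

/-- A prime factor of `N` has exponent `1` or `2` under admissibility. [cite: Stevens1982, §2.4 (PDF pp. 35–37)] -/
theorem factorization_eq_one_or_two_of_admissible (hadm : IsAdmissibleStabData N β) {ℓ : ℕ}
    (hℓ : ℓ ∈ N.primeFactors) : N.factorization ℓ = 1 ∨ N.factorization ℓ = 2 := by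
  have hle := hadm.1 ℓ hℓ
  have hpos : 0 < N.factorization ℓ := by
    rw [← Nat.support_factorization, Finsupp.mem_support_iff] at hℓ
    omega
  omega

/-- **Modularity of the stabilised Eisenstein series: `∑_{t ∣ N} c_t = 0`** (`= ∏_ℓ L_ℓ(1)`; the factor at a
fully depleted prime, or at a prime with `β_ℓ = ℓ`, vanishes). [cite: Stevens1982, §2.4–2.5 (PDF pp. 35–38)] -/
theorem sum_divisors_stabCoeff_eq_zero (hN : N ≠ 0) (hadm : IsAdmissibleStabData N β) :
    ∑ t ∈ N.divisors, stabCoeff N β t = 0 := by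
  have h := sum_divisors_stabCoeff_mul N β (R := ℚ) (fun _ ↦ (1 : ℚ)) rfl (fun _ _ _ _ _ ↦ (mul_one _).symm) hN
  simp only [Algebra.algebraMap_self, RingHom.id_apply, mul_one] at h
  rw [h]
  -- a vanishing local factor
  have key : ∃ ℓ ∈ N.primeFactors, ∑ j ∈ Finset.range (N.factorization ℓ + 1), stabCoeff N β (ℓ ^ j) = 0 := by
    have hloc : ∀ ℓ ∈ N.primeFactors, (N.factorization ℓ = 2 ∨ (N.factorization ℓ = 1 ∧ β ℓ = ℓ)) →
        ∑ j ∈ Finset.range (N.factorization ℓ + 1), stabCoeff N β (ℓ ^ j) = 0 := by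
      intro ℓ hℓ hcase
      have hℓ0 : (ℓ : ℚ) ≠ 0 := by exact_mod_cast (Nat.prime_of_mem_primeFactors hℓ).ne_zero
      simp only [stabCoeff_prime_pow N β hℓ]
      rcases hcase with h2 | ⟨h1, hb⟩
      · have := sum_range_localStabCoeff_of_eq_two N β (R := ℚ) h2 1
        simp only [one_pow, mul_one, Algebra.algebraMap_self, RingHom.id_apply] at this
        rw [this]
        field_simp
        ring
      · have := sum_range_localStabCoeff_of_eq_one N β (R := ℚ) h1 1
        simp only [one_pow, mul_one, Algebra.algebraMap_self, RingHom.id_apply] at this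
        rw [this, hb, div_self hℓ0, sub_self]
    rcases hadm.2.2 with ⟨ℓ, hℓ, h2⟩ | ⟨⟨ℓ, hℓ, hb⟩, -⟩
    · exact ⟨ℓ, hℓ, hloc ℓ hℓ (Or.inl h2)⟩
    · rcases factorization_eq_one_or_two_of_admissible hadm hℓ with h1 | h2
      · exact ⟨ℓ, hℓ, hloc ℓ hℓ (Or.inr ⟨h1, hb⟩)⟩
      · exact ⟨ℓ, hℓ, hloc ℓ hℓ (Or.inl h2)⟩
  obtain ⟨ℓ, hℓ, h0⟩ := key
  exact Finset.prod_eq_zero hℓ h0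

/-- **Cuspidality at `∞` of the 2-power tower: `∑_{t ∣ N} c_t · t = 0`** (`= ∏_ℓ L̃_ℓ(ℓ)`; the factor at a fully
depleted prime, or at a prime with `β_ℓ = 1`, vanishes). [cite: Stevens1982, §2.4–2.5 (PDF pp. 35–38)] -/
theorem sum_divisors_stabCoeff_mul_self_eq_zero (hN : N ≠ 0) (hadm : IsAdmissibleStabData N β) :
    ∑ t ∈ N.divisors, stabCoeff N β t * t = 0 := by
  have h := sum_divisors_stabCoeff_mul N β (R := ℚ) (fun t ↦ (t : ℚ)) Nat.cast_one
    (fun m n _ _ _ ↦ Nat.cast_mul m n) hN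
  simp only [Algebra.algebraMap_self, RingHom.id_apply] at h
  rw [h]
  have key : ∃ ℓ ∈ N.primeFactors,
      ∑ j ∈ Finset.range (N.factorization ℓ + 1), stabCoeff N β (ℓ ^ j) * ((ℓ ^ j : ℕ) : ℚ) = 0 := by
    have hloc : ∀ ℓ ∈ N.primeFactors, (N.factorization ℓ = 2 ∨ (N.factorization ℓ = 1 ∧ β ℓ = 1)) →
        ∑ j ∈ Finset.range (N.factorization ℓ + 1), stabCoeff N β (ℓ ^ j) * ((ℓ ^ j : ℕ) : ℚ) = 0 := by
      intro ℓ hℓ hcase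
      have hℓ0 : (ℓ : ℚ) ≠ 0 := by exact_mod_cast (Nat.prime_of_mem_primeFactors hℓ).ne_zero
      simp only [stabCoeff_prime_pow N β hℓ, Nat.cast_pow]
      rcases hcase with h2 | ⟨h1, hb⟩
      · have := sum_range_localStabCoeff_of_eq_two N β (R := ℚ) h2 (ℓ : ℚ)
        simp only [Algebra.algebraMap_self, RingHom.id_apply] at this
        rw [this]
        field_simp
        ring
      · have := sum_range_localStabCoeff_of_eq_one N β (R := ℚ) h1 (ℓ : ℚ)
        simp only [Algebra.algebraMap_self, RingHom.id_apply] at this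
        rw [this, hb]
        field_simp
        ring
    rcases hadm.2.2 with ⟨ℓ, hℓ, h2⟩ | ⟨-, ⟨ℓ, hℓ, hb⟩⟩
    · exact ⟨ℓ, hℓ, hloc ℓ hℓ (Or.inl h2)⟩
    · rcases factorization_eq_one_or_two_of_admissible hadm hℓ with h1 | h2
      · exact ⟨ℓ, hℓ, hloc ℓ hℓ (Or.inr ⟨h1, hb⟩)⟩
      · exact ⟨ℓ, hℓ, hloc ℓ hℓ (Or.inl h2)⟩
  obtain ⟨ℓ, hℓ, h0⟩ := key
  exact Finset.prod_eq_zero hℓ h0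

/-! ### 2-adic size of the coefficients (odd level) -/

/-- For odd `N`, every prime factor of `N` is odd, hence a `2`-adic unit: `‖ℓ‖₂ = 1`. [folklore] -/
theorem norm_natCast_eq_one_of_mem_primeFactors_odd (hodd : Odd N) {ℓ : ℕ} (hℓ : ℓ ∈ N.primeFactors) :
    ‖(ℓ : ℚ_[2])‖ = 1 := by
  rw [Padic.norm_natCast_eq_one_iff]
  refine (Nat.coprime_primes Nat.prime_two (Nat.prime_of_mem_primeFactors hℓ)).mpr ?_
  rintro rfl
  exact (Nat.not_even_iff_odd.mpr hodd) (even_iff_two_dvd.mpr (Nat.dvd_of_mem_primeFactors hℓ))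

/-- **`c_ℓ(j) ∈ ℤ₂`** for odd `N`: the local coefficients are `1, −β_ℓ/ℓ, −(1+ℓ)/ℓ, 1/ℓ, 0` with `ℓ` odd.
[cite: Stevens1982, §2.4 (PDF pp. 35–37)] -/
theorem norm_localStabCoeff_le_one (hodd : Odd N) {ℓ : ℕ} (hℓ : ℓ ∈ N.primeFactors) (j : ℕ) :
    ‖((localStabCoeff N β ℓ j : ℚ) : ℚ_[2])‖ ≤ 1 := by
  have hℓ1 := norm_natCast_eq_one_of_mem_primeFactors_odd hodd hℓ
  have hnat : ∀ k : ℕ, ‖((k : ℚ) : ℚ_[2])‖ ≤ 1 := fun k ↦ by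
    rw [Rat.cast_natCast]; exact_mod_cast Padic.norm_int_le_one (p := 2) (k : ℤ)
  unfold localStabCoeff
  split_ifs <;> push_cast <;>
    simp only [norm_zero, norm_one, norm_neg, norm_div, hℓ1, div_one, zero_le_one, le_refl] <;>
    first
    | exact_mod_cast Padic.norm_int_le_one (p := 2) (β ℓ : ℤ)
    | exact (Padic.nonarchimedean _ _).trans (max_le (by rw [norm_one]) (by rw [hℓ1]))

/-- **`c_t ∈ ℤ₂`** for odd `N`. [cite: Stevens1982, §2.4 (PDF pp. 35–37)] -/
theorem norm_stabCoeff_le_one (hodd : Odd N) (t : ℕ) : ‖((stabCoeff N β t : ℚ) : ℚ_[2])‖ ≤ 1 := by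
  unfold stabCoeff
  push_cast
  rw [norm_prod]
  exact Finset.prod_le_one (fun _ _ ↦ norm_nonneg _) fun ℓ hℓ ↦ norm_localStabCoeff_le_one hodd hℓ _

end StabCoeff

end Summit.BirchSwinnertonDyer.BirchSwinnertonDyer.Theorems.DepletionAtTwo

end
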